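import Summits.BirchSwinnertonDyer.Rank1Residual.WAll.Target
import Summits.BirchSwinnertonDyer.BirchSwinnertonDyer.Theorems.SignedLowerHalvesRowC3BSTWScopeS
import Literature.NumberTheory.EllipticCurves.BurungaleSkinnerTianWan2024.IntroductionTheoremsOPEN
import HarnessLib

/-!
# Rung W-ALL (D-0120): ALT-CLOSERS BY NAME from ANNOUNCED (pre-publication) results — rows 6, 9, 10
# (cell `bsd-wall`, lane 2, seat ty-2; supplement to `WAll/AltClosers*.lean`, data line bsd-litref bstw24 2026-08-27T02:55Z)

HONEST FRAMING (cell `bsd-wall`, run/shared/lean/pub/bsd-wall/; WALL-BRIEF-v1 §2). NOTHING ASSERTED;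
no `def`, no `@[conjecture]`, no named fact, no route file imported. Every theorem here closes a W-ALL
row or sub-case of `WAll/Target.lean` CONDITIONALLY on a named `…_OPEN` binder that types a result of
the PREPRINT Burungale–Skinner–Tian–Wan, arXiv:2409.01350v2 (2024) — typed ≠ proved ≠ endorsed; the
binders are hypotheses exactly as in their home files, never restated — plus the tree's named
PUBLISHED facts. Kept in a separate module so that the leaf-level registry (`AltClosersGlue.lean`)
stays free of preprint binders.

* Row 6 «X6 ∧ r = 0» at every odd `p` ⇐ BSTW24 Thm 1.3 in the cell-scoped tiers S5 (`p ≥ 5`,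
  `Supersingular.BurungaleSkinnerTianWan2024_thm13_scopedS_OPEN`) and S3 (`p = 3`,
  `…_scopedAtThreeS_OPEN`), through the landed kernel
  `Theorems.X6_bsdp_of_tiersS_S3_of_analyticRank_eq_zero` (p489313; Pollack 2003 discharged inside).
* Rows 9 / 10, the rank-one RAMIFIED sub-cases ⇐ BSTW24 Thm 1.9 (ordinary branch, no semistability /
  surjectivity / `p ≥ 5` hypothesis: `BurungaleSkinnerTianWan2024.thm19_pPart_rankOne_ordinary_OPEN`),
  through the landed `BurungaleSkinnerTianWan2024.bsdp_of_thm19_OPEN`: «ClassX9 ∧ r = 1 ∧ Ram» and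
  «ClassX10 ∧ ¬Surj ∧ r = 1 ∧ Ram W 3».
What these do NOT touch: row 6 beyond the scoped tiers' own hypotheses; rows 9/10 in rank `0`, or in
rank `1` without a (ram) witness; row 7 (BSTW covers only a quadratic-twist sub-family, consumers
`Supersingular.X7.bsdp_of_BSTW13_twist_OPEN_of_analyticRank_eq_zero` etc., not re-exported here);
row 8 (nothing at `a₃ = ±3`).

References: [cite: BurungaleSkinnerTianWan2024, Thm. 1.3, Thm. 1.9 (arXiv:2409.01350v2; PRE)];
`Theorems/SignedLowerHalvesRowC3BSTWScopeS.lean`; `Literature/…/BurungaleSkinnerTianWan2024/IntroductionTheoremsOPEN.lean`;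
pub/bsd-litref/bstw24/staging/bsd-litref-bstw24-pv/CONSUMERS.md v1.6.
-/

noncomputable section

open scoped Classical

open WeierstrassCurve Literature.NumberTheory.EllipticCurves
  Literature.NumberTheory.EllipticCurves.ModularForms
  Literature.NumberTheory.EllipticCurves.Rank1Residual
  Literature.NumberTheory.EllipticCurves.Rank1Residual.Typed
  Literature.NumberTheory.EllipticCurves.Wuthrich2014

set_option autoImplicit false

namespace Summit.BirchSwinnertonDyer.Rank1Residual.WAll

open Summit.BirchSwinnertonDyer
open Summit.BirchSwinnertonDyer.Rank1Residual.Supersingular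
  (BurungaleSkinnerTianWan2024_thm13_scopedS_OPEN BurungaleSkinnerTianWan2024_thm13_scopedAtThreeS_OPEN)

/-! ## Row 6 — X6 ∧ r = 0 from BSTW24 Thm 1.3 (scoped tiers, PRE) -/

/-- **Row 6 (`WAllCornerX6r0`) ⇐ BSTW24 Thm 1.3, tiers S5 ∧ S3 (PRE binders) + published facts**
(Wuthrich `Ш ∣ Ш_an`, Kobayashi 2003 Thm 1.2, B.D. Kim 2013 Cor 3.15, modularity ×3, GZK, Diamond's
refined Serre), through `Theorems.X6_bsdp_of_tiersS_S3_of_analyticRank_eq_zero`. CONDITIONAL on the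
two preprint tiers; nothing booked. [cite: BurungaleSkinnerTianWan2024, Thm. 1.3 (PRE)] -/
theorem wallCornerX6r0_of_BSTW13_tiers (h5t : BurungaleSkinnerTianWan2024_thm13_scopedS_OPEN)
    (h3t : BurungaleSkinnerTianWan2024_thm13_scopedAtThreeS_OPEN) (hW : sha_dvd_analyticSha)
    (h12 : Kobayashi2003.thm12_signedSelmerDual_finite_torsion)
    (hKim : BDKim2013.cor315_signedCharValue_rankZero) (hmodP : nonempty_modularParametrizationData)
    (hmod' : hasEntireLFunction_rat) (hGZK : rank_eq_analyticRank_of_analyticRank_le_one)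
    (hmod : exists_isNewformOf) (hLL : Literature.NumberTheory.Automorphic.diamond1995_refinedSerre) :
    WAllCornerX6r0 :=
  fun W _ _ p _ _ hp hX h0 ↦
    BirchSwinnertonDyer.Theorems.X6_bsdp_of_tiersS_S3_of_analyticRank_eq_zero h5t h3t hW h12 hKim
      hmodP hmod' hGZK hmod hLL W p hp hX h0

/-! ## Rows 9 / 10 — the rank-one ramified sub-cases from BSTW24 Thm 1.9 (PRE) -/

/-- **Row 9, sub-case «ClassX9 ∧ r = 1 ∧ (ram)» ⇐ BSTW24 Thm 1.9** (PRE binder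
`thm19_pPart_rankOne_ordinary_OPEN`: good ordinary odd `p`, `E[p]` irreducible, a (ram) witness,
`r = 1` ⇒ the `p`-part; GZK), through `BurungaleSkinnerTianWan2024.bsdp_of_thm19_OPEN`. X9's
`¬ Surj` and non-semistability are simply not needed by the binder. CONDITIONAL; nothing booked.
[cite: BurungaleSkinnerTianWan2024, Thm. 1.9 (PRE)] -/
theorem cornerX9_rankOne_ram_of_BSTW19
    (hB : BurungaleSkinnerTianWan2024.thm19_pPart_rankOne_ordinary_OPEN)
    (hGZK : rank_eq_analyticRank_of_analyticRank_le_one) :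
    ∀ (W : WeierstrassCurve ℚ) [W.IsElliptic] [W.IsGloballyMinimal] (p : ℕ) [Fact p.Prime],
      ClassX9 W p → W.analyticRank = 1 → Ram W p → BSDp W p := by
  intro W _ _ p _ hX h1 hram
  obtain ⟨-, hord, h5, hirr, -, -⟩ := hX
  exact BurungaleSkinnerTianWan2024.bsdp_of_thm19_OPEN hB hGZK W p (by omega) hord hirr hram h1

/-- **Row 10, sub-case «ClassX10 ∧ ¬Surj ∧ r = 1 ∧ (ram at 3)» ⇐ BSTW24 Thm 1.9** (same binder at
`p = 3`; `ClassX10` supplies good ordinary `3` and `E[3]` irreducible). CONDITIONAL; nothing booked.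
[cite: BurungaleSkinnerTianWan2024, Thm. 1.9 (PRE)] -/
theorem cornerX10b_rankOne_ram_of_BSTW19
    (hB : BurungaleSkinnerTianWan2024.thm19_pPart_rankOne_ordinary_OPEN)
    (hGZK : rank_eq_analyticRank_of_analyticRank_le_one) :
    ∀ (W : WeierstrassCurve ℚ) [W.IsElliptic] [W.IsGloballyMinimal] (p : ℕ) [Fact p.Prime],
      ClassX10 W p → ¬ Surj W p → W.analyticRank = 1 → Ram W p → BSDp W p := by
  intro W _ _ p _ hX _ h1 hram
  obtain ⟨hp3, hord, hirr, -⟩ := hX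
  subst hp3
  exact BurungaleSkinnerTianWan2024.bsdp_of_thm19_OPEN hB hGZK W 3 (by decide) hord hirr hram h1

/-- **Rows 9 and 10 reduced by BSTW24 Thm 1.9**: granted the PRE binder, `WAllCornerX9` follows from
its rank-`0` part and its rank-`1` part WITHOUT a (ram) witness, and likewise `WAllCornerX10b` — the
exact residual shape left for the planners of rows 9/10. CONDITIONAL; nothing booked.
[cite: BurungaleSkinnerTianWan2024, Thm. 1.9 (PRE)] -/
theorem wallCornerX9_of_BSTW19_of_residual
    (hB : BurungaleSkinnerTianWan2024.thm19_pPart_rankOne_ordinary_OPEN)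
    (hGZK : rank_eq_analyticRank_of_analyticRank_le_one)
    (h0 : ∀ (W : WeierstrassCurve ℚ) [W.IsElliptic] [W.IsGloballyMinimal] (p : ℕ) [Fact p.Prime],
      ClassX9 W p → W.analyticRank = 0 → BSDp W p)
    (h1 : ∀ (W : WeierstrassCurve ℚ) [W.IsElliptic] [W.IsGloballyMinimal] (p : ℕ) [Fact p.Prime],
      ClassX9 W p → W.analyticRank = 1 → ¬ Ram W p → BSDp W p) : WAllCornerX9 := by
  intro W _ _ p _ hX hr
  rcases Nat.le_one_iff_eq_zero_or_eq_one.mp hr with hr0 | hr1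
  · exact h0 W p hX hr0
  · by_cases hram : Ram W p
    · exact cornerX9_rankOne_ram_of_BSTW19 hB hGZK W p hX hr1 hram
    · exact h1 W p hX hr1 hram

/-- Row 10 likewise: `WAllCornerX10b` from BSTW24 Thm 1.9 (PRE) and the residual «`r = 0`» ∪
«`r = 1` without (ram) at `3`» parts. CONDITIONAL; nothing booked.
[cite: BurungaleSkinnerTianWan2024, Thm. 1.9 (PRE)] -/
theorem wallCornerX10b_of_BSTW19_of_residual
    (hB : BurungaleSkinnerTianWan2024.thm19_pPart_rankOne_ordinary_OPEN)
    (hGZK : rank_eq_analyticRank_of_analyticRank_le_one)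
    (h0 : ∀ (W : WeierstrassCurve ℚ) [W.IsElliptic] [W.IsGloballyMinimal] (p : ℕ) [Fact p.Prime],
      ¬ W.HasCM → ClassX10 W p → ¬ Surj W p → W.analyticRank = 0 → BSDp W p)
    (h1 : ∀ (W : WeierstrassCurve ℚ) [W.IsElliptic] [W.IsGloballyMinimal] (p : ℕ) [Fact p.Prime],
      ¬ W.HasCM → ClassX10 W p → ¬ Surj W p → W.analyticRank = 1 → ¬ Ram W p → BSDp W p) :
    WAllCornerX10b := by
  intro W _ _ p _ hcm hX hns hr
  rcases Nat.le_one_iff_eq_zero_or_eq_one.mp hr with hr0 | hr1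
  · exact h0 W p hcm hX hns hr0
  · by_cases hram : Ram W p
    · exact cornerX10b_rankOne_ram_of_BSTW19 hB hGZK W p hX hns hr1 hram
    · exact h1 W p hcm hX hns hr1 hram

end Summit.BirchSwinnertonDyer.Rank1Residual.WAll

end
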